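import Mathlib

/-!
# `AcyclicBisectionRigidity` — negative-side support: the type-count invariant of achiral Hurwitz orbits

Support lemma for the crux
`Summit.SmoothPoincare4.SmoothPoincare4.Theses.ConvexBisection.AcyclicBisectionRigidity`
(stmt-SmoothPoincare4-10507), from the standing disprover's work file
`Cruxes/AcyclicBisectionRigidity/Disproof.lean` §13c (gen 5).

The round-2 crux card `achiral-relator-reduction` proposes the lever `T`: the achiral monodromy
word `w = F·F̄′` of a bisected homotopy sphere reduces to the empty word by achiral Hurwitz moves
`(a, b) ↦ (b, b⁻¹ab)`, `(a, b) ↦ (aba⁻¹, a)`, cyclic rotation, global conjugation and DELETION of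
adjacent mutually inverse pairs (its inductive `MonotoneReducible`, constructors
`nil / cancel / hurwitz / hurwitzInv / rotate / conj`, transcribed here over an arbitrary group).
This file proves the obstruction the card itself names ("type vectors must agree"), in the form
used by the Disproof to REFUTE `T` at `k = 5`: for every conjugation-invariant predicate `S` on the
group, the signed count `#{i | wᵢ ∈ S} − #{i | wᵢ⁻¹ ∈ S}` is invariant under every move and is `0`
on the empty word (`typeCount_eq_zero_of_monotoneReducible`); so a word with non-zero count for
some such `S` is not monotone reducible, in whatever group it lives and whether or not it
represents the identity (`not_monotoneReducible_of_typeCount_ne_zero`). The Disproof's explicit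
relation `t₂₃₄ t₁₂₃ t*₁₃₄ t₃ = t₂₃ t_∂ t₃₄ t*₁₃` in `Mod(P₅, ∂)` has count `1` for `S` = the
conjugacy class of `t₂₃₄`.
-/

-- The namespace is prescribed by the crux protocol (`Summit.<P>.<Sub>.Theorems.<Crux>.Negative`
-- with `P = Sub = SmoothPoincare4`), hence the duplicated component.
set_option linter.dupNamespace false

namespace Summit.SmoothPoincare4.SmoothPoincare4.Theorems.AcyclicBisectionRigidity.Negative

/-- **The move set of the lever `T` (card `achiral-relator-reduction`) on words over a group**:
deletion of an adjacent mutually inverse pair, the two achiral Hurwitz moves at any position,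
cyclic rotation, global conjugation — read backwards from the empty word (our transcription of the
card's `MonotoneReducible`). [folklore] -/
inductive MonotoneReducible {G : Type*} [Group G] : List G → Prop
  | nil : MonotoneReducible []
  | cancel (l₁ l₂ : List G) (g : G) :
      MonotoneReducible (l₁ ++ l₂) → MonotoneReducible (l₁ ++ g :: g⁻¹ :: l₂)
  | hurwitz (l₁ l₂ : List G) (a b : G) :
      MonotoneReducible (l₁ ++ b :: (b⁻¹ * a * b) :: l₂) → MonotoneReducible (l₁ ++ a :: b :: l₂)
  | hurwitzInv (l₁ l₂ : List G) (a b : G) :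
      MonotoneReducible (l₁ ++ (a * b * a⁻¹) :: a :: l₂) → MonotoneReducible (l₁ ++ a :: b :: l₂)
  | rotate (l : List G) (k : ℕ) : MonotoneReducible (l.rotate k) → MonotoneReducible l
  | conj (l : List G) (g : G) :
      MonotoneReducible (l.map fun x => g * x * g⁻¹) → MonotoneReducible l

/-- **The signed `S`-count of a word**: letters in `S` minus letters whose inverse is in `S`
(for `S` a conjugacy class of Dehn twists: the type vector entry of the card). [folklore] -/
def typeCount {G : Type*} [Group G] (S : G → Prop) [DecidablePred S] (l : List G) : ℤ :=
  (l.countP fun x => S x : ℤ) - (l.countP fun x => S x⁻¹ : ℤ)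

section TypeCount

variable {G : Type*} [Group G] (S : G → Prop) [DecidablePred S]

/-- The empty word has count `0`. [folklore] -/
theorem typeCount_nil : typeCount S ([] : List G) = 0 := by simp [typeCount]

/-- The count is additive under concatenation. [folklore] -/
theorem typeCount_append (l₁ l₂ : List G) :
    typeCount S (l₁ ++ l₂) = typeCount S l₁ + typeCount S l₂ := by
  simp [typeCount, List.countP_append]; ring

/-- The count of a word with one more letter. [folklore] -/
theorem typeCount_cons (g : G) (l : List G) :
    typeCount S (g :: l) = ((if S g then 1 else 0) - (if S g⁻¹ then 1 else 0)) + typeCount S l := by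
  by_cases h1 : S g <;> by_cases h2 : S g⁻¹ <;> simp [typeCount, h1, h2] <;> ring

/-- The count is invariant under permutations of the word (in particular cyclic rotations). [folklore] -/
theorem typeCount_perm {l l' : List G} (h : l.Perm l') : typeCount S l = typeCount S l' := by
  simp [typeCount, h.countP_eq]

variable (hS : ∀ g x : G, S x ↔ S (g * x * g⁻¹))
include hS

/-- For conjugation-invariant `S` the count is invariant under global conjugation. [folklore] -/
theorem typeCount_map_conj (g : G) (l : List G) :
    typeCount S (l.map fun x => g * x * g⁻¹) = typeCount S l := by
  induction l with
  | nil => simp [typeCount]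
  | cons x l ih =>
    rw [List.map_cons, typeCount_cons, typeCount_cons, ih]
    have h1 : S (g * x * g⁻¹) ↔ S x := (hS g x).symm
    have h2 : S (g * x * g⁻¹)⁻¹ ↔ S x⁻¹ := by
      rw [show (g * x * g⁻¹)⁻¹ = g * x⁻¹ * g⁻¹ by group]
      exact (hS g x⁻¹).symm
    simp only [h1, h2]

/-- **The type count is an invariant of the move set and vanishes on monotone-reducible words**
(induction on the derivation: a deletion removes `g, g⁻¹`; a Hurwitz move replaces one letter by a
conjugate of itself; rotations permute; global conjugation by `typeCount_map_conj`). This is the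
"type vector" obstruction named in the card's item (7). [folklore] -/
theorem typeCount_eq_zero_of_monotoneReducible {l : List G} (h : MonotoneReducible l) :
    typeCount S l = 0 := by
  induction h with
  | nil => exact typeCount_nil S
  | cancel l₁ l₂ g _ ih =>
    rw [typeCount_append] at ih
    rw [typeCount_append, typeCount_cons, typeCount_cons, inv_inv]
    linarith
  | hurwitz l₁ l₂ a b _ ih =>
    rw [typeCount_append, typeCount_cons, typeCount_cons] at ih ⊢
    have h1 : S (b⁻¹ * a * b) ↔ S a := by
      have := hS b⁻¹ a; simpa using this.symm
    have h2 : S (b⁻¹ * a * b)⁻¹ ↔ S a⁻¹ := by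
      rw [show (b⁻¹ * a * b)⁻¹ = b⁻¹ * a⁻¹ * b by group]
      have := hS b⁻¹ a⁻¹; simpa using this.symm
    simp only [h1, h2] at ih
    linarith
  | hurwitzInv l₁ l₂ a b _ ih =>
    rw [typeCount_append, typeCount_cons, typeCount_cons] at ih ⊢
    have h1 : S (a * b * a⁻¹) ↔ S b := (hS a b).symm
    have h2 : S (a * b * a⁻¹)⁻¹ ↔ S b⁻¹ := by
      rw [show (a * b * a⁻¹)⁻¹ = a * b⁻¹ * a⁻¹ by group]
      exact (hS a b⁻¹).symm
    simp only [h1, h2] at ih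
    linarith
  | rotate l k _ ih => rwa [typeCount_perm S (List.rotate_perm l k)] at ih
  | conj l g _ ih => rwa [typeCount_map_conj S hS] at ih

/-- **Contrapositive (the form used to refute the lever `T`)**: a word with non-zero type count for
some conjugation-invariant `S` is NOT monotone reducible. [folklore] -/
theorem not_monotoneReducible_of_typeCount_ne_zero {l : List G} (h : typeCount S l ≠ 0) :
    ¬ MonotoneReducible l :=
  fun hr => h (typeCount_eq_zero_of_monotoneReducible S hS hr)

end TypeCount

/-- **A minimal abstract instance**: in any group, for a conjugation-invariant `S` with `S a`,
`¬ S a⁻¹`, `¬ S b`, `¬ S b⁻¹`, the two-letter word `[a, b⁻¹]` is not monotone reducible — ONE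
mismatched class suffices, whatever relation `a = b · …` may hold in the group (shape of the
Disproof's use, where the positive and negative type multisets are even disjoint). [folklore] -/
theorem not_monotoneReducible_pair {G : Type*} [Group G] (S : G → Prop) [DecidablePred S]
    (hS : ∀ g x : G, S x ↔ S (g * x * g⁻¹)) {a b : G}
    (ha : S a) (ha' : ¬ S a⁻¹) (hb : ¬ S b) (hb' : ¬ S b⁻¹) :
    ¬ MonotoneReducible [a, b⁻¹] := by
  refine not_monotoneReducible_of_typeCount_ne_zero S hS ?_
  simp [typeCount, ha, ha', hb, hb']

end Summit.SmoothPoincare4.SmoothPoincare4.Theorems.AcyclicBisectionRigidity.Negative
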